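import Literature.NumberTheory.LFunctions.ClassicalPsiErrorTerm
import Literature.NumberTheory.LFunctions.DedekindZetaHalfPlaneProofs
import Literature.NumberTheory.LFunctions.DedekindZetaVonMangoldt
import Literature.NumberTheory.LFunctions.IdealCountProofs
import Literature.NumberTheory.LFunctions.PrimeIdealPsi
import HarnessLib

/-!
# The prime ideal theorem from Landau's half-plane continuation of `ζ_K`

Topic `Literature/NumberTheory/LFunctions`. Everything in this file is PROVED.

We assemble the proof of the prime ideal theorem with de la Vallée-Poussin error term
(`Literature.NumberTheory.LFunctions.NumberField.primeIdealTheorem`, Landau 1903; Montgomery–Vaughan Theorem 8.9) from the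
generic analytic machinery of the topic:

* `ClassicalZeroFreeRegion.lean` — the classical zero-free region and `G'/G ≪ log τ`
  (MV Theorems 6.6–6.7) for an abstract pair `(Λ, G)` (`Literature.NumberTheory.LFunctions.ClassicalZFRData`);
* `ClassicalPsiErrorTerm.lean` — `ψ_Λ(x) = x + O(x e^{−c√log x})` from it (MV Theorem 6.9; Landau
  1903 §§5–8) via Perron's formula of order one and a contour shift;
* `DedekindZetaVonMangoldt.lean` — `−ζ_K'/ζ_K = ∑ Λ_K(n) n^{-s}`, `ζ_K ≠ 0` on `σ > 1`;
* `DedekindZetaHalfPlane(Proofs).lean` — Landau's continuation `G(s) = (s − 1)ζ_K(s)` to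
  `σ > 1 − 1/d` with `ζ_K(s) ≪ |t|` (named fact `exists_isLandauContinuation K`, proved there from
  the ideal-counting estimate `idealCount_sub_residue_mul_le K`, MV (8.43));
* `IdealCountProofs.lean` — the ideal-counting estimate itself, for every `K` (Marcus, *Number
  Fields*, Thm. 39; MV (8.43));
* `PrimeIdealPsi.lean`, `PrimeIdealChebyshev.lean` — `ψ_K ⇒ θ_K ⇒ π_K` (Landau 1903 §13).

Results (namespace `Literature.NumberField`):

* `classicalZFRData_of_isLandauContinuation` — a Landau continuation with MV's growth bound
  satisfies `ClassicalZFRData (Λ_K) G (1/(2d))`;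
* `abs_chebyshevPsiIdeal_sub_le` — `exists_isLandauContinuation K ⇒ |ψ_K(x) − x| ≤ C x e^{−c√log x}`
  (MV Theorem 8.9 for `ψ_K`);
* `primeIdealTheorem_of_exists_isLandauContinuation`, `primeIdealTheorem_of_idealCount` — the
  prime ideal theorem from Landau's continuation for every `K`, resp. from the Weber–Landau ideal
  count `I_K(x) = ρ_K x + O(x^{1−1/d})` for every `K`;
* `exists_isLandauContinuation_holds`, `landauContinuation_zeroFree_holds`,
  `chebyshevPsiPrimeIdealTheorem_holds`, `chebyshevThetaPrimeIdealTheorem_holds` — discharges of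
  the named facts of `DedekindZetaHalfPlane.lean`, `PrimeIdealPsi.lean`, `PrimeIdealChebyshev.lean`;
* `primeIdealTheorem_holds : primeIdealTheorem` — **the prime ideal theorem with
  de la Vallée-Poussin error term, unconditionally**, the ideal count being proved in
  `IdealCountProofs.lean` (`idealCount_sub_residue_mul_le_holds`, Marcus Theorem 39 via the
  lattice-point theorem `Algebra/EuclideanLattices/LatticePointCounting.lean` and
  `FundamentalConeBoundary.lean`).

## References

* E. Landau, *Neuer Beweis des Primzahlsatzes und Beweis des Primidealsatzes*, Math. Ann. 56
  (1903), 645–670, §§9–13 (`LandauMathAnn1903`).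
* H. L. Montgomery, R. C. Vaughan, *Multiplicative Number Theory I. Classical Theory*, CUP 2007,
  §8.4, pp. 266–268, Theorem 8.9 (`MontgomeryVaughan2007`).
-/

noncomputable section

open Complex Filter Set Real
open scoped Topology NumberField

namespace Literature.NumberTheory.LFunctions.NumberField

variable (K : Type*) [Field K] [NumberField K]

/-- `1 ≤ d = [K : ℚ]`. [folklore] -/
theorem one_le_finrank : (1 : ℝ) ≤ (Module.finrank ℚ K : ℝ) := by
  exact_mod_cast Module.finrank_pos (R := ℚ) (M := K)

variable {K}

/-- **Landau's continuation satisfies the hypotheses of the classical zero-free-region argument**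
(Montgomery–Vaughan p. 267: "as in Chapter 6 we may derive a zero-free region for `ζ_K(s)`"):
if `G` is a Landau continuation of `(s − 1)ζ_K(s)` to `σ > 1 − 1/d` with `G(1) = ρ_K` and
`|G(s)/(s − 1)| ≤ C_δ |t|` for `σ ≥ 1 − 1/d + δ`, `|t| ≥ 1`, then `ClassicalZFRData Λ_K G (1/(2d))`:
`Λ_K ≥ 0`, `Λ_K(1) = 0`, `∑ Λ_K n^{-s}` converges absolutely and `G'/G = 1/(s−1) − ∑ Λ_K n^{-s}`
on `σ > 1` (`−ζ_K'/ζ_K = ∑ Λ_K n^{-s}`), `G(1) = ρ_K ≠ 0`, and `|G(s)| ≤ C (|t| + 4)²` in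
`1 − 1/(2d) < σ ≤ 3`. [cite: MontgomeryVaughan2007, p. 267] -/
theorem classicalZFRData_of_isLandauContinuation {G : ℂ → ℂ} (hG : IsLandauContinuation K G)
    (hG1 : G 1 = (NumberField.dedekindZeta_residue K : ℂ))
    (hgrowth : ∀ δ : ℝ, 0 < δ → ∃ C : ℝ, ∀ s : ℂ,
      1 - 1 / (Module.finrank ℚ K : ℝ) + δ ≤ s.re → 1 ≤ |s.im| → ‖G s / (s - 1)‖ ≤ C * |s.im|) :
    ClassicalZFRData (vonMangoldtIdeal K) G (1 / (2 * (Module.finrank ℚ K : ℝ))) := by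
  set d : ℝ := (Module.finrank ℚ K : ℝ) with hd
  have hd1 : 1 ≤ d := one_le_finrank K
  have hd0 : 0 < d := by linarith
  set η : ℝ := 1 / (2 * d) with hη
  have hη0 : 0 < η := by positivity
  have hη1 : η ≤ 1 := by
    rw [hη, div_le_one (by positivity)]; linarith
  have hηd : 1 - 1 / d + η = 1 - η := by rw [hη]; field_simp; ring
  -- the half-plane `σ > 1 − η` lies in Landau's half-plane
  have hsub : {s : ℂ | 1 - η < s.re} ⊆ landauHalfPlane K := by
    intro s hs
    simp only [landauHalfPlane, Set.mem_setOf_eq] at hs ⊢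
    have : η ≤ 1 / d := by
      rw [hη, div_le_div_iff_of_pos_left one_pos (by positivity) hd0]; linarith
    linarith
  have hopen1 : IsOpen {s : ℂ | 1 < s.re} := continuous_re.isOpen_preimage _ isOpen_Ioi
  refine
    { eta_pos := hη0
      eta_le_one := hη1
      nonneg := vonMangoldtIdeal_nonneg K
      map_one := vonMangoldtIdeal_one K
      summable := fun s hs ↦ LSeriesSummable_vonMangoldtIdeal K hs
      differentiableOn := hG.differentiableOn.mono hsub
      ne_zero := fun s hs ↦ ?_
      logDeriv_eq := fun s hs ↦ ?_
      map_one_ne := ?_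
      growth := ?_ }
  · rw [hG.eq_mul s hs]
    refine mul_ne_zero ?_ (dedekindZeta_ne_zero_of_one_lt_re K hs)
    intro h0
    have := congrArg Complex.re h0
    simp at this
    linarith
  · -- `G'/G = 1/(s−1) + ζ_K'/ζ_K = 1/(s−1) − L(Λ_K)`
    have hev : G =ᶠ[𝓝 s] fun z ↦ (z - 1) * NumberField.dedekindZeta K z := by
      filter_upwards [hopen1.mem_nhds hs] with z hz
      exact hG.eq_mul z hz
    have hζ := hasDerivAt_dedekindZeta K hs
    have hprod : HasDerivAt (fun z ↦ (z - 1) * NumberField.dedekindZeta K z)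
        (1 * NumberField.dedekindZeta K s + (s - 1) *
          -(NumberField.dedekindZeta K s * LSeries (fun n ↦ (vonMangoldtIdeal K n : ℂ)) s)) s :=
      ((hasDerivAt_id s).sub_const 1).mul hζ
    rw [hev.deriv_eq, hprod.deriv, hG.eq_mul s hs]
    have hζ0 := dedekindZeta_ne_zero_of_one_lt_re K hs
    have hs1 : s - 1 ≠ 0 := by
      intro h0; have := congrArg Complex.re h0; simp at this; linarith
    field_simp
    ring
  · rw [hG1]
    exact_mod_cast NumberField.dedekindZeta_residue_ne_zero K
  · -- growth: `|G(s)| ≤ C (|t|+4)²` for `1 − η < σ ≤ 3`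
    obtain ⟨C₁, hC₁⟩ := hgrowth η hη0
    set K₀ : Set ℂ := Icc (1 - η) 3 ×ℂ Icc (-1) 1 with hK₀
    have hK₀c : IsCompact K₀ := isCompact_Icc.reProdIm isCompact_Icc
    have hηd' : η < 1 / d := by
      rw [hη, div_lt_div_iff_of_pos_left one_pos (by positivity) hd0]; linarith
    have hK₀sub : K₀ ⊆ landauHalfPlane K := by
      intro s hs
      obtain ⟨⟨h1, -⟩, -⟩ := hs
      simp only [landauHalfPlane, Set.mem_setOf_eq]
      linarith
    have hcont : ContinuousOn G K₀ := hG.differentiableOn.continuousOn.mono hK₀sub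
    obtain ⟨M, hM⟩ := hK₀c.exists_bound_of_continuousOn hcont
    have hmax1 : 0 ≤ max C₁ 0 := le_max_right _ _
    have hmax2 : 0 ≤ max M 0 := le_max_right _ _
    refine ⟨2, max C₁ 0 + max M 0, by norm_num, fun s hs1 hs3 ↦ ?_⟩
    rw [Real.rpow_two]
    have ht0 : 0 ≤ |s.im| := abs_nonneg _
    rcases le_or_gt 1 |s.im| with ht | ht
    · -- `|t| ≥ 1`: the growth hypothesis
      have hb := hC₁ s (by rw [hηd]; exact hs1.le) ht
      have hs1ne : s - 1 ≠ 0 := by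
        intro h0
        have := congrArg Complex.im h0
        simp at this
        rw [this, abs_zero] at ht
        linarith
      have hGs : ‖G s‖ = ‖G s / (s - 1)‖ * ‖s - 1‖ := by
        rw [norm_div, div_mul_cancel₀ _ (norm_ne_zero_iff.2 hs1ne)]
      have hnorm : ‖s - 1‖ ≤ |s.im| + 4 := by
        calc ‖s - 1‖ ≤ |(s - 1).re| + |(s - 1).im| := Complex.norm_le_abs_re_add_abs_im _
          _ = |s.re - 1| + |s.im| := by simp
          _ ≤ 4 + |s.im| := by
              gcongr
              rw [abs_le]; constructor <;> linarith
          _ = |s.im| + 4 := by ring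
      have hb0 : 0 ≤ C₁ * |s.im| := (norm_nonneg _).trans hb
      calc ‖G s‖ = ‖G s / (s - 1)‖ * ‖s - 1‖ := hGs
        _ ≤ (C₁ * |s.im|) * (|s.im| + 4) := mul_le_mul hb hnorm (norm_nonneg _) hb0
        _ ≤ (max C₁ 0 * (|s.im| + 4)) * (|s.im| + 4) := by
            refine mul_le_mul_of_nonneg_right ?_ (by positivity)
            calc C₁ * |s.im| ≤ max C₁ 0 * |s.im| :=
                  mul_le_mul_of_nonneg_right (le_max_left _ _) ht0
              _ ≤ max C₁ 0 * (|s.im| + 4) := by gcongr; linarith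
        _ ≤ (max C₁ 0 + max M 0) * (|s.im| + 4) ^ 2 := by nlinarith
    · -- `|t| < 1`: compactness
      have hsK : s ∈ K₀ :=
        ⟨⟨hs1.le, hs3⟩, ⟨by linarith [(abs_lt.1 ht).1], by linarith [(abs_lt.1 ht).2]⟩⟩
      have h16 : (1 : ℝ) ≤ (|s.im| + 4) ^ 2 := by nlinarith
      calc ‖G s‖ ≤ M := hM s hsK
        _ ≤ (max C₁ 0 + max M 0) * 1 := by linarith [le_max_left M 0]
        _ ≤ (max C₁ 0 + max M 0) * (|s.im| + 4) ^ 2 := by gcongr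

variable (K) in
/-- **MV Theorem 8.9 for `ψ_K`** (Landau 1903, (57) p. 669 with a weaker exponent): Landau's
continuation of `ζ_K` (the named fact `exists_isLandauContinuation K`) implies
`|ψ_K(x) − x| ≤ C x exp(−c √log x)` for `x ≥ 2`, with `c > 0`, `C` depending on `K`.
[cite: MontgomeryVaughan2007, Theorem 8.9] -/
theorem abs_chebyshevPsiIdeal_sub_le (h : exists_isLandauContinuation K) :
    ∃ c : ℝ, 0 < c ∧ ∃ C : ℝ, ∀ x : ℝ, 2 ≤ x →
      |chebyshevPsiIdeal K x - x| ≤ C * x * Real.exp (-c * Real.sqrt (Real.log x)) := by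
  obtain ⟨G, hG, hG1, hgr⟩ := h
  have hZ := classicalZFRData_of_isLandauContinuation hG hG1 hgr
  obtain ⟨c, hc, C, hb⟩ := hZ.abs_psi_sub_le
  refine ⟨c, hc, C, fun x hx ↦ ?_⟩
  have heq : chebyshevPsiIdeal K x = ∑ n ∈ Finset.Ioc 0 ⌊x⌋₊, vonMangoldtIdeal K n := by
    rw [chebyshevPsiIdeal, ← Finset.sum_Ioc_add_eq_sum_Icc (Nat.zero_le _), vonMangoldtIdeal_zero,
      add_zero]
  rw [heq]
  exact hb x hx

/-- **`ψ_K`-form of the prime ideal theorem from Landau's continuation** for every number field.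
[cite: MontgomeryVaughan2007, Theorem 8.9] -/
theorem chebyshevPsiPrimeIdealTheorem_of_exists_isLandauContinuation
    (h : ∀ (K : Type) [Field K] [NumberField K], exists_isLandauContinuation K) :
    chebyshevPsiPrimeIdealTheorem := fun K _ _ ↦ abs_chebyshevPsiIdeal_sub_le K (h K)

/-- **The prime ideal theorem from Landau's continuation** (Landau 1903: properties 1)–4) of `ζ_κ`,
p. 666, imply the Primidealsatz, pp. 666–670; MV Theorem 8.9): if `ζ_K` has a Landau continuation
for every number field `K`, then `primeIdealTheorem` holds. [cite: LandauMathAnn1903, §§9–13] -/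
theorem primeIdealTheorem_of_exists_isLandauContinuation
    (h : ∀ (K : Type) [Field K] [NumberField K], exists_isLandauContinuation K) :
    primeIdealTheorem :=
  primeIdealTheorem_of_chebyshevPsi (chebyshevPsiPrimeIdealTheorem_of_exists_isLandauContinuation h)

/-- **The prime ideal theorem from the Weber–Landau ideal count** `I_K(x) = ρ_K x + O(x^{1−1/d})`
(MV (8.43) ⇒ continuation (p. 267) ⇒ zero-free region ⇒ Theorem 8.9): if
`idealCount_sub_residue_mul_le K` holds for every number field `K`, then `primeIdealTheorem`
holds. [cite: MontgomeryVaughan2007, pp. 266–268] -/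
theorem primeIdealTheorem_of_idealCount
    (h : ∀ (K : Type) [Field K] [NumberField K], idealCount_sub_residue_mul_le K) :
    primeIdealTheorem :=
  primeIdealTheorem_of_exists_isLandauContinuation fun K _ _ ↦
    exists_isLandauContinuation_of_idealCount K (h K)

/-! ## Discharge of the named facts of the topic -/

variable (K) in
/-- **Landau's half-plane continuation of `ζ_K` exists** (discharge of the named fact
`exists_isLandauContinuation K` of `DedekindZetaHalfPlane.lean`; Landau 1903, p. 666 property 1);
Montgomery–Vaughan p. 267): from the ideal count (`idealCount_sub_residue_mul_le_holds`) by partial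
summation (`exists_isLandauContinuation_of_idealCount`). [cite: LandauMathAnn1903, §9 p. 666] -/
theorem exists_isLandauContinuation_holds : exists_isLandauContinuation K :=
  exists_isLandauContinuation_of_idealCount K (idealCount_sub_residue_mul_le_holds K)

variable (K) in
/-- **Zero-free region for `ζ_K`** (discharge of the named fact `landauContinuation_zeroFree K`;
Montgomery–Vaughan p. 267 with Theorem 6.6; Landau 1903 (55) weaker): there is `c_K > 0` with
`G(s) ≠ 0` for every Landau continuation `G = (s − 1)ζ_K` and every `s` of Landau's half-plane
with `σ > 1 − c_K/log(|t| + 4)`. From `ClassicalZFRData.zeroFree` for the continuation of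
`exists_isLandauContinuation_holds` (region shrunk to `c ≤ (log 4)/(2d)` so that it lies in the
strip `σ > 1 − 1/(2d)`), transported to all Landau continuations by uniqueness.
[cite: MontgomeryVaughan2007, p. 267 (with Thm 6.6)] -/
theorem landauContinuation_zeroFree_holds : landauContinuation_zeroFree K := by
  obtain ⟨G₀, hG₀, hG₀1, hgr⟩ := exists_isLandauContinuation_holds K
  have hZ := classicalZFRData_of_isLandauContinuation hG₀ hG₀1 hgr
  obtain ⟨c, hc, hzf⟩ := hZ.zeroFree
  set d : ℝ := (Module.finrank ℚ K : ℝ) with hd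
  have hd0 : 0 < d := by rw [hd]; exact_mod_cast Module.finrank_pos
  have hlog4 : 0 < Real.log 4 := Real.log_pos (by norm_num)
  refine ⟨min c (Real.log 4 / (2 * d)), lt_min hc (by positivity), fun G hG s hs hσ ↦ ?_⟩
  rw [hG.unique hG₀ hs]
  have hℓ : Real.log 4 ≤ Real.log (|s.im| + 4) :=
    Real.log_le_log (by norm_num) (by linarith [abs_nonneg s.im])
  have hℓ0 : 0 < Real.log (|s.im| + 4) := hlog4.trans_le hℓ
  have h1 : min c (Real.log 4 / (2 * d)) / Real.log (|s.im| + 4) ≤ c / Real.log (|s.im| + 4) :=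
    div_le_div_of_nonneg_right (min_le_left _ _) hℓ0.le
  have h2 : min c (Real.log 4 / (2 * d)) / Real.log (|s.im| + 4) ≤ 1 / (2 * d) := by
    rw [div_le_iff₀ hℓ0]
    calc min c (Real.log 4 / (2 * d)) ≤ Real.log 4 / (2 * d) := min_le_right _ _
      _ = 1 / (2 * d) * Real.log 4 := by ring
      _ ≤ 1 / (2 * d) * Real.log (|s.im| + 4) := by gcongr
  exact hzf s (by linarith) (by linarith)

/-- **`ψ_K(x) = x + O_K(x e^{−c√log x})` for every number field** (discharge of the named fact
`chebyshevPsiPrimeIdealTheorem` of `PrimeIdealPsi.lean`; Montgomery–Vaughan Theorem 8.9 /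
(6.12); Landau 1903 (57) weaker). [cite: MontgomeryVaughan2007, Theorem 8.9] -/
theorem chebyshevPsiPrimeIdealTheorem_holds : chebyshevPsiPrimeIdealTheorem :=
  chebyshevPsiPrimeIdealTheorem_of_exists_isLandauContinuation fun K _ _ ↦
    exists_isLandauContinuation_holds K

/-- **`θ_K(x) = x + O_K(x e^{−c√log x})` for every number field** (discharge of the named fact
`chebyshevThetaPrimeIdealTheorem` of `PrimeIdealChebyshev.lean`; Montgomery–Vaughan Theorem 8.9;
Landau 1903 (57)). [cite: MontgomeryVaughan2007, Theorem 8.9] -/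
theorem chebyshevThetaPrimeIdealTheorem_holds : chebyshevThetaPrimeIdealTheorem :=
  chebyshevThetaPrimeIdealTheorem_of_chebyshevPsi chebyshevPsiPrimeIdealTheorem_holds

/-- **The prime ideal theorem** (Landau 1903, *Neuer Beweis des Primzahlsatzes und Beweis des
Primidealsatzes*, Math. Ann. 56, Part II, pp. 665–670: `π_κ(x) ∼ Li(x)`, with an error term
`O(x e^{−(log x)^{1/γ}})`; in the de la Vallée-Poussin form `π_K(x) = Li(x) + O_K(x e^{−c√log x})`
of Montgomery–Vaughan, *Multiplicative Number Theory I*, Theorem 8.9, which is the vendored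
statement `Literature.NumberTheory.LFunctions.NumberField.primeIdealTheorem`): PROVED for every number field, by Landau's
method — ideal counting `I_K(x) = ρ_K x + O(x^{1−1/d})` (`idealCount_sub_residue_mul_le_holds`),
continuation of `ζ_K` to `σ > 1 − 1/d` by partial summation, the classical zero-free region and
`ζ_K'/ζ_K ≪ log τ`, Perron's formula of order one with a contour shift, de-smoothing, and
`ψ_K ⇒ θ_K ⇒ π_K`. [cite: LandauMathAnn1903, Part II §§9–13, pp. 665–670] -/
theorem primeIdealTheorem_holds : primeIdealTheorem :=
  primeIdealTheorem_of_idealCount fun K _ _ ↦ idealCount_sub_residue_mul_le_holds K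

end Literature.NumberTheory.LFunctions.NumberField

end
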